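import Literature.AlgebraicGeometry.ModuliOfAbelianVarieties.SiegelShimuraSetIndexMultiplier
import Literature.AlgebraicGeometry.ModuliOfAbelianVarieties.SiegelPrincipalLevelCompact
import Literature.AlgebraicGeometry.ModuliOfAbelianVarieties.SiegelTransporterBounds
import Literature.NumberTheory.Automorphic.StrongApproximationGL2
import Literature.NumberTheory.Adeles.RatFiniteIdeleCongruenceClasses
import HarnessLib

/-!
# Integral representatives `diag(1_g, u·1_g)`, `u ∈ ẑ^×`, of the piece index `GSp_δ(ℚ)∖GSp_δ(𝔸_f)/K`, and its finiteness at principal level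

Topic `AlgebraicGeometry/ModuliOfAbelianVarieties`; namespace `Literature.AlgebraicGeometry.ModuliOfAbelianVarieties.SiegelShimuraSet`.
THEOREMS ONLY (no definition, no named fact, no instance, no `sorry`); everything consumed BY NAME:
★ R60-21 file A `SiegelShimuraSetIndexMultiplier` (common multiplier ⇒ same index, strong approximation for `Sp_{2g}`),
★ R60-18 `SiegelPrincipalLevelCompact` (`K_δ(1)/K_δ(N)` finite), ★ R60-4 `SiegelPrincipalLevelMultiplier` (the section
`u ↦ diag(1_g, u·1_g) ∈ K_δ(N)`), ★ R60-20 `SymplecticSimilitudeMultiplierSection` (the section over `ℚ`), ★ R60-13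
`SiegelShimuraSetDissection` (`Index`, `indexOf`), ★ `Rat.FiniteAdeleRing.exists_pos_valued_algebraMap_mul_eq_one`
(`𝔸_{ℚ,f}^× = ℚ_{>0}·ẑ^×`, class number one of `ℤ`), ★ R60-12 `Adeles.RatFiniteIdeleCongruenceClasses` (`ẑ`-unit bridge).

* §1 `ẑ`-units are `≡ 1 (mod 1·𝓞̂)` (over ★ R60-12's bridge `forall_valued_eq_one_iff_mem_integralAdeles`).
* §2 **CLASS NUMBER ONE FOR `GSp_δ`** (`doubleCosetMk_eq_integral_diag`): for every OPEN `K` and every `a ∈ GSp_δ(𝔸_{ℚ,f})` there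
  is a `ẑ`-unit `u` with `GSp_δ(ℚ)·a·K = GSp_δ(ℚ)·d(u)·K`, `d(u) = diag(1_g, u·1_g) ∈ K_δ(1) = GSp_δ(ẑ)` — i.e.
  `GSp_δ(𝔸_{ℚ,f}) = GSp_δ(ℚ) · GSp_δ(ẑ)` read on double cosets ([Milne2005ShimuraVarieties] Lemma 5.12, Thm. 5.17 with
  `ν(K_δ(1)) = ẑ^×`, `ℚ_{>0}·ẑ^× = 𝔸_f^×`); `exists_integral_diag_indexOf_eq` (★ R60-13 spelling).
* §3 **FINITENESS** (`finite_index_principalLevelSubgroup`): `Ξ_{K_δ(N)} = GSp_δ(ℚ)∖GSp_δ(𝔸_{ℚ,f})/K_δ(N)` is FINITE for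
  `N ≠ 0` (`0 < g`, `0 < δ_i`): it is the image of the finite group `K_δ(1)/K_δ(N)` (★ R60-18); `finite_index_siegelLevel`
  is the `finite_Q`-shaped corollary the Mumford line's `SiegelComplexRecordSystem.Q K := Index δ K.1` consumes.

Cell `hodgecm-mathlib`, #60 road (A-p05 TABLE v1.11, R60-21B′ «index representatives»; the Σ-assembly over these
representatives is B-p05's R60-27 capstone); banked generic leaf, books 0.
D-CITE docstring edition (lit2 audit `lit/D-CITE-AUDIT-ClusterI-II.md` row :76 + §E anchor, grade A): [Milne2005ShimuraVarieties]
Thm. 5.17 re-paged 61 → 59 (statement p. 59; proof pp. 60–61) and the printed `π₀(Sh_{K(N)}) ≃ (ℤ/Nℤ)^×` paragraph §6 p. 75 added as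
the anchor of §3; only docstring text changed — every declaration, statement and proof is byte-identical to ★ p656554.
HC_CM is proved only modulo the 7 printed citations until rung 0 closes.

## References
* [Milne2005ShimuraVarieties] J. S. Milne, *Introduction to Shimura varieties* (2005; 2017 revision), §4 Thm. 4.16 p. 48, Rem. 4.17 (a)
  p. 48, Lemma 5.12 p. 57, Lemma 5.13 p. 57, Thm. 5.17 p. 59 (statement; proof pp. 60–61), §6 p. 70, §6 p. 75 («`K(N) ∩ S(ℚ) = Γ(N)`
  … `π₀(Sh_{K(N)}(G,X)) ≃ (ℤ/Nℤ)^×`»).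
* [Deligne1971TravauxShimura] P. Deligne, *Travaux de Shimura* (1971), 1.8 p. 129, Exemple 4.16 p. 150.
* [Gelbart1975] S. Gelbart, *Automorphic forms on adele groups* (1975), (3.3).
-/

set_option autoImplicit false

noncomputable section

open Matrix NumberField IsDedekindDomain
open _root_.Topology

namespace Literature.AlgebraicGeometry.ModuliOfAbelianVarieties

/-! ### §1. `ẑ`-units are `≡ 1 (mod 1·𝓞̂)` -/

section Units

/-- A `ẑ`-unit `u` (all local absolute values `1`; ★ R60-12's bridge `forall_valued_eq_one_iff_mem_integralAdeles` gives
`u, u⁻¹ ∈ 𝓞̂`) is `≡ 1 (mod 1·𝓞̂)` together with its inverse — the level-`1` congruence is integrality, i.e. the hypotheses of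
★ R60-4 `exists_mem_principalLevelSubgroup_isMultiplier (N := 1)`. [cite: Deligne1971TravauxShimura, Exemple 4.16 p. 150] -/
theorem sub_one_mem_levelIdeal_one_of_forall_valued_eq_one {u : finAdeleQˣ}
    (hu : ∀ v : HeightOneSpectrum (𝓞 ℚ), Valued.v ((u : finAdeleQ) v) = 1) :
    (u : finAdeleQ) - 1 ∈ levelIdeal 1 ∧ ((u⁻¹ : finAdeleQˣ) : finAdeleQ) - 1 ∈ levelIdeal 1 := by
  obtain ⟨h1, h2⟩ := (Literature.NumberTheory.Adeles.forall_valued_eq_one_iff_mem_integralAdeles u).1 hu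
  refine ⟨mem_levelIdeal_iff.2 ⟨_, Subring.sub_mem _ h1 (one_mem _), ?_⟩,
    mem_levelIdeal_iff.2 ⟨_, Subring.sub_mem _ h2 (one_mem _), ?_⟩⟩ <;>
    rw [Nat.cast_one, one_mul]

end Units

/-! ### §2. Class number one for `GSp_δ`: integral diagonal representatives of every double coset -/

namespace SiegelShimuraSet

variable {g : ℕ} (δ : Fin g → ℕ) (K : Subgroup (gspFinAdelic δ))

/-- **`GSp_δ(𝔸_{ℚ,f}) = GSp_δ(ℚ) · diag(1_g, ẑ^×·1_g) · K` for every OPEN `K`**: every double coset `GSp_δ(ℚ)·a·K` contains an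
INTEGRAL diagonal element `d(u) = diag(1_g, u·1_g) ∈ K_δ(1) = GSp_δ(ẑ)` with `u ∈ ẑ^×` and multiplier `u` (`0 < δ_i`).
Proof: `ν(a) = q⁻¹·u` with `q ∈ ℚ_{>0}`, `u ∈ ẑ^×` (★ `Rat.FiniteAdeleRing.exists_pos_valued_algebraMap_mul_eq_one`); the rational
section `γ_q` (★ R60-20) and the integral section `d(u)` (★ R60-4) give `γ_{q⁻¹} d(u)` the multiplier of `a`; conclude by
★ R60-21 file A (strong approximation). [cite: Milne2005ShimuraVarieties, Lemma 5.12 p. 57, Thm. 5.17 p. 59]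
[cite: Deligne1971TravauxShimura, Exemple 4.16 p. 150] -/
theorem doubleCosetMk_eq_integral_diag (hδ : ∀ i, 0 < δ i) (hK : IsOpen (K : Set (gspFinAdelic δ))) (a : gspFinAdelic δ) :
    ∃ (u : finAdeleQˣ) (x : gspFinAdelic δ), (∀ v : HeightOneSpectrum (𝓞 ℚ), Valued.v ((u : finAdeleQ) v) = 1) ∧
      x ∈ principalLevelSubgroup δ 1 ∧
      IsMultiplier (typeFormOver δ finAdeleQ) (x : GL (Fin g ⊕ Fin g) finAdeleQ) u ∧
      ((x : GL (Fin g ⊕ Fin g) finAdeleQ) : Matrix (Fin g ⊕ Fin g) (Fin g ⊕ Fin g) finAdeleQ) =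
        Matrix.fromBlocks 1 0 0 ((u : finAdeleQ) • (1 : Matrix (Fin g) (Fin g) finAdeleQ)) ∧
      DoubleCoset.mk (gspRationalToFinAdelic δ).range K a = DoubleCoset.mk (gspRationalToFinAdelic δ).range K x := by
  -- the multiplier `t` of `a` and its factorisation `q·t ∈ ẑ^×`
  obtain ⟨t, ht⟩ := a.2
  obtain ⟨r, hr, hru⟩ := Literature.NumberTheory.Automorphic.Rat.FiniteAdeleRing.exists_pos_valued_algebraMap_mul_eq_one t
  let q : ℚˣ := Units.mk0 r hr.ne'
  let u : finAdeleQˣ := Units.map (algebraMap ℚ finAdeleQ).toMonoidHom q * t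
  have hu_coe : (u : finAdeleQ) = algebraMap ℚ finAdeleQ r * t := by
    simp only [u, q, Units.val_mul, Units.coe_map, RingHom.toMonoidHom_eq_coe, MonoidHom.coe_coe, Units.val_mk0]
  have hu : ∀ v : HeightOneSpectrum (𝓞 ℚ), Valued.v ((u : finAdeleQ) v) = 1 := fun v => by rw [hu_coe]; exact hru v
  -- the integral section `d(u) ∈ K_δ(1)` (★ R60-4)
  obtain ⟨hu1, hu2⟩ := sub_one_mem_levelIdeal_one_of_forall_valued_eq_one hu
  obtain ⟨x, hx1, hxu, hxd⟩ := exists_mem_principalLevelSubgroup_isMultiplier δ (N := 1) u hu1 hu2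
  -- the rational section `γ` with multiplier `q⁻¹` (★ R60-20)
  obtain ⟨d, hd, hdq, -⟩ := exists_mem_similitudeGroupOfForm_typeFormOver_isMultiplier δ ℚ q⁻¹
  let γ : gspRational δ := ⟨d, hd⟩
  -- `γ · d(u) · 1` has the multiplier `t` of `a`
  have hmult : IsMultiplier (typeFormOver δ finAdeleQ)
      ((gspRationalToFinAdelic δ γ * x * 1 : gspFinAdelic δ) : GL (Fin g ⊕ Fin g) finAdeleQ)
      (Units.map (algebraMap ℚ finAdeleQ).toMonoidHom q⁻¹ * u * 1) :=
    isMultiplier_rational_mul_mul δ hdq hxu (IsMultiplier.one _)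
  have ht_eq : Units.map (algebraMap ℚ finAdeleQ).toMonoidHom q⁻¹ * u * 1 = t := by
    rw [mul_one, map_inv, inv_mul_cancel_left]
  rw [ht_eq] at hmult
  refine ⟨u, x, hu, hx1, hxu, hxd, ?_⟩
  calc DoubleCoset.mk (gspRationalToFinAdelic δ).range K a
      = DoubleCoset.mk (gspRationalToFinAdelic δ).range K (gspRationalToFinAdelic δ γ * x * 1) :=
        doubleCosetMk_eq_of_isMultiplier δ K hδ hK ht hmult
    _ = DoubleCoset.mk (gspRationalToFinAdelic δ).range K x := by
        rw [eq_comm, DoubleCoset.eq]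
        exact ⟨gspRationalToFinAdelic δ γ, ⟨γ, rfl⟩, 1, K.one_mem, rfl⟩

/-- ★ R60-13 spelling: **every index `q ∈ Ξ_K` is `indexOf δ K d(u)` for an integral diagonal `d(u) = diag(1_g, u·1_g) ∈ K_δ(1)`,
`u ∈ ẑ^×`** (`K` open, `0 < δ_i`) — the explicit representatives of [Milne2005ShimuraVarieties] Lemma 5.13 «Let `𝒞` be a set of
representatives …». [cite: Milne2005ShimuraVarieties, Lemma 5.12 p. 57, Lemma 5.13 p. 57] -/
theorem exists_integral_diag_indexOf_eq (hδ : ∀ i, 0 < δ i) (hK : IsOpen (K : Set (gspFinAdelic δ))) (q : Index δ K) :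
    ∃ (u : finAdeleQˣ) (x : gspFinAdelic δ), (∀ v : HeightOneSpectrum (𝓞 ℚ), Valued.v ((u : finAdeleQ) v) = 1) ∧
      x ∈ principalLevelSubgroup δ 1 ∧
      IsMultiplier (typeFormOver δ finAdeleQ) (x : GL (Fin g ⊕ Fin g) finAdeleQ) u ∧
      ((x : GL (Fin g ⊕ Fin g) finAdeleQ) : Matrix (Fin g ⊕ Fin g) (Fin g ⊕ Fin g) finAdeleQ) =
        Matrix.fromBlocks 1 0 0 ((u : finAdeleQ) • (1 : Matrix (Fin g) (Fin g) finAdeleQ)) ∧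
      indexOf δ K x = q := by
  obtain ⟨a, rfl⟩ := indexOf_surjective δ K q
  obtain ⟨u, x, hu, hx1, hxu, hxd, hax⟩ := doubleCosetMk_eq_integral_diag δ K hδ hK a
  exact ⟨u, x, hu, hx1, hxu, hxd, hax.symm⟩

/-- **`K_δ(1) = GSp_δ(ẑ)` meets every double coset**: `indexOf δ K` restricted to `K_δ(1)` is onto (`K` open, `0 < δ_i`).
[cite: Milne2005ShimuraVarieties, Lemma 5.12 p. 57, Thm. 5.17 p. 59] -/
theorem indexOf_surjOn_principalLevelSubgroup_one (hδ : ∀ i, 0 < δ i) (hK : IsOpen (K : Set (gspFinAdelic δ))) :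
    Set.SurjOn (indexOf δ K) (principalLevelSubgroup δ 1 : Set (gspFinAdelic δ)) Set.univ := by
  intro q _
  obtain ⟨u, x, -, hx1, -, -, hq⟩ := exists_integral_diag_indexOf_eq δ K hδ hK q
  exact ⟨x, hx1, hq⟩

/-! ### §3. Finiteness of the piece index at principal level -/

/-- **`Ξ_{K_δ(N)} = GSp_δ(ℚ)∖GSp_δ(𝔸_{ℚ,f})/K_δ(N)` is FINITE** (`N ≠ 0`, `0 < g`, `0 < δ_i`): it is the image of the finite
group `K_δ(1)/K_δ(N)` (★ R60-18 `finite_quotient_principalLevelSubgroup`) under `x ↦ indexOf x`, which is onto by class number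
one for `GSp_δ` (§2).  This is the finiteness of the set `𝒞` of [Milne2005ShimuraVarieties] Lemma 5.12/5.13 for the Siegel
datum, i.e. of `π₀` of `Sh_{K(N)}(GSp_δ, S^±)` (printed for `δ = (1,…,1)` as «`π₀(Sh_{K(N)}(G,X)) ≃ (ℤ/Nℤ)^×`», §6 p. 75).
[cite: Milne2005ShimuraVarieties, Lemma 5.12 p. 57, Lemma 5.13 p. 57, §6 p. 75]
[cite: Deligne1971TravauxShimura, 1.8 p. 129] -/
theorem finite_index_principalLevelSubgroup (hg : 0 < g) (hδ : ∀ i, 0 < δ i) {N : ℕ} (hN : N ≠ 0) :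
    Finite (Index δ (principalLevelSubgroup δ N)) := by
  classical
  -- the finite group `K_δ(1)/K_δ(N)`
  haveI : Finite (principalLevelSubgroup δ 1 ⧸ (principalLevelSubgroup δ N).subgroupOf (principalLevelSubgroup δ 1)) :=
    finite_quotient_principalLevelSubgroup δ hg hδ one_ne_zero hN
  -- `indexOf` factors through it
  let f : principalLevelSubgroup δ 1 ⧸ (principalLevelSubgroup δ N).subgroupOf (principalLevelSubgroup δ 1) →
      Index δ (principalLevelSubgroup δ N) := fun c =>
    Quotient.liftOn' c (fun x => indexOf δ (principalLevelSubgroup δ N) (x : gspFinAdelic δ)) fun x y hxy => by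
      have h : ((x⁻¹ * y : principalLevelSubgroup δ 1) : gspFinAdelic δ) ∈ principalLevelSubgroup δ N :=
        Subgroup.mem_subgroupOf.1 (QuotientGroup.leftRel_apply.mp hxy)
      exact (indexOf_eq_indexOf_iff δ _ _ _).2 ⟨1, (x : gspFinAdelic δ)⁻¹ * y, h, by rw [map_one]; group⟩
  refine Finite.of_surjective f fun q => ?_
  obtain ⟨u, x, -, hx1, -, -, hq⟩ :=
    exists_integral_diag_indexOf_eq δ (principalLevelSubgroup δ N) hδ (isOpen_principalLevelSubgroup δ hN) q
  exact ⟨QuotientGroup.mk ⟨x, hx1⟩, hq⟩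

/-- The `finite_Q`-shaped corollary for the Siegel levels: **`Ξ_K` is finite for every `K : SiegelLevel δ`** (`0 < g`, `0 < δ_i`).
[cite: Milne2005ShimuraVarieties, Lemma 5.13 p. 57] [cite: Deligne1971TravauxShimura, 1.8 p. 129] -/
theorem finite_index_siegelLevel (hg : 0 < g) (hδ : ∀ i, 0 < δ i) (K : SiegelLevel δ) :
    Finite (Index δ (K.1 : Subgroup (gspFinAdelic δ))) := by
  rw [K.val_eq]
  exact finite_index_principalLevelSubgroup δ hg hδ (by have := K.three_le_N; omega)

/-- **Finitely many pieces**: the image of ★ R60-13's `index : Sh_K(GSp_δ, S^±)(ℂ) → Ξ_K` is a finite set of indices for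
`K = K_δ(N)` — `Sh_{K(N)}` is a FINITE disjoint union of arithmetic quotients `Γ_ξ∖S^±` (★ `equivSigma`).
[cite: Milne2005ShimuraVarieties, Lemma 5.13 p. 57] -/
theorem finite_range_index (hg : 0 < g) (hδ : ∀ i, 0 < δ i) {N : ℕ} (hN : N ≠ 0) :
    (Set.range (index δ (principalLevelSubgroup δ N))).Finite :=
  haveI := finite_index_principalLevelSubgroup δ hg hδ hN
  Set.toFinite _

end SiegelShimuraSet

end Literature.AlgebraicGeometry.ModuliOfAbelianVarieties

end
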